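import Literature.NumberTheory.Transcendental.HolonomyBoundCounting
import Literature.NumberTheory.Transcendental.HolonomyBoundJumps
import Literature.NumberTheory.Transcendental.HolonomyBoundGerms
import Literature.NumberTheory.Transcendental.HolonomyBoundDen
import Mathlib.Tactic
import HarnessLib

/-!
# The basic arithmetic holonomy bound, IV-c: the box inequality `T^{mD} ≤ Π_p γ_p`

Calegari–Dimitrov–Tang, arXiv:2408.15403, Appendix §17 (pp. 129–130): for `ℚ(x)`-linearly
independent `f₁,…,f_m` of denominator type `(b₁,…,b_r)`, the `T^{mD}` outputs
`F = Σ Qᵢfᵢ` (`Qᵢ ∈ ℤ[x]_{<D}`, coefficients in `[0,T)`) inject into the tree of their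
coefficients at the jumps `u(1) < ⋯ < u(mD)` (§17.1), whose level-`p` branching is at most
`γ_p = 1 + 2A_p · den(u(p))` (§17.2) as soon as any two outputs agreeing below `x^{u(p)}` have
`x^{u(p)}`-coefficients within `A_p` of each other. Hence
**`T^{mD} = #𝒪_D ≤ Π_p (1 + 2A_p den(u(p)))`** — the inequality displayed before
"At this point, we look at the last inequality asymptotically in `T → ∞`" (p. 130).

This file proves that inequality (`HolonomyBound.box_inequality`) with the analytic input of
§17.3 abstracted into a hypothesis: a bound `|β| ρⁿ ≤ K` for the lowest non-zero coefficient
`β` (at `xⁿ`) of any difference of two outputs, giving `A_p = K / ρ^{u(p)}` (in CDT,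
`ρ = |φ'(0)|` and `K = T · (sup_𝕋 max(|u|,|v|))^D · mD · sup_𝕋 |h φ^*fᵢ|` from the Cauchy
estimate eq. (sup bound); the holomorphic case of that estimate is
`HolonomyBoundGerms.norm_coeff_combo_mul_pow_le`). It assembles `HolonomyBoundCounting`
(tree counting, lattice points), `HolonomyBoundJumps` (the jumps `u`) and `HolonomyBoundDen`
(denominators). The asymptotic endgame (`T`, then `D → ∞`) giving
`m ≤ 2 log M / (log ρ − Σ bⱼ)` is in the sequel file. No named facts.

## References

* [CalegariDimitrovTang2024] arXiv:2408.15403, Appendix §17, §§17.1–17.3 (pp. 129–130).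
-/

noncomputable section

open Filter Metric Finset PowerSeries
open scoped Topology

namespace Literature.NumberTheory.Transcendental

namespace HolonomyBound

variable {m r : ℕ}

/-! ### The functions `fᵢ` and the generating family `X^j fᵢ` -/

/-- The coefficients `a i k / den b k` of `fᵢ` (denominator type `b`, integer numerators `a`).
[cite: CalegariDimitrovTang2024, Appendix §17.1 eq. (gen den form)] -/
def cfOf (b : Fin r → ℕ) (a : Fin m → ℕ → ℤ) (i : Fin m) (k : ℕ) : ℚ :=
  (a i k : ℚ) / den b k

/-- `fᵢ = Σ_k (a i k / den b k) x^k ∈ ℚ⟦x⟧`.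
[cite: CalegariDimitrovTang2024, Appendix §17.1 eq. (gen den form)] -/
def fser (b : Fin r → ℕ) (a : Fin m → ℕ → ℤ) (i : Fin m) : PowerSeries ℚ :=
  PowerSeries.mk (cfOf b a i)

/-- The generating family of the evaluation module in degree `< D`: `(i, j) ↦ X^j · fᵢ`
(the images of the basis of `ℤ[x]^{⊕m}_{deg<D}` under `ψ_D`).
[cite: CalegariDimitrovTang2024, Appendix §17.1 eq. (eval)] -/
def genFamily (b : Fin r → ℕ) (a : Fin m → ℕ → ℤ) (D : ℕ) :
    Fin m × Fin D → PowerSeries ℚ :=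
  fun ij => (X : PowerSeries ℚ) ^ (ij.2 : ℕ) * fser b a ij.1

/-- `combo` is the linear combination of the generating family. [folklore] -/
theorem combo_eq_sum_genFamily (b : Fin r → ℕ) (a : Fin m → ℕ → ℤ) {D : ℕ}
    (c : Fin m → Fin D → ℚ) :
    combo (cfOf b a) c = ∑ i : Fin m, ∑ j : Fin D, c i j • genFamily b a D (i, j) := rfl

/-- `combo` is additive/linear in the coefficients: differences. [folklore] -/
theorem combo_sub (cf : Fin m → ℕ → ℚ) {D : ℕ} (c₁ c₂ : Fin m → Fin D → ℚ) :
    combo cf c₁ - combo cf c₂ = combo cf (fun i j => c₁ i j - c₂ i j) := by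
  simp only [combo, sub_smul, Finset.sum_sub_distrib]

/-- Combinations lie in the span of the generating family. [folklore] -/
theorem combo_mem_span (b : Fin r → ℕ) (a : Fin m → ℕ → ℤ) {D : ℕ}
    (c : Fin m → Fin D → ℚ) :
    combo (cfOf b a) c ∈ Submodule.span ℚ (Set.range (genFamily b a D)) := by
  rw [combo_eq_sum_genFamily]
  refine Submodule.sum_mem _ fun i _ => Submodule.sum_mem _ fun j _ =>
    Submodule.smul_mem _ _ (Submodule.subset_span ⟨(i, j), rfl⟩)

/-- Injectivity of the evaluation map from linear independence: `combo c = 0 ⟹ c = 0`.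
[cite: CalegariDimitrovTang2024, Appendix §17.1 "the evaluation map (eval) is injective"] -/
theorem combo_eq_zero_imp (b : Fin r → ℕ) (a : Fin m → ℕ → ℤ) {D : ℕ}
    (hindep : LinearIndependent ℚ (genFamily b a D)) (c : Fin m → Fin D → ℚ)
    (h : combo (cfOf b a) c = 0) : ∀ i j, c i j = 0 := by
  intro i j
  have h' : ∑ ij : Fin m × Fin D, c ij.1 ij.2 • genFamily b a D ij = 0 := by
    rw [Fintype.sum_prod_type]
    rw [combo_eq_sum_genFamily] at h
    exact h
  exact Fintype.linearIndependent_iff.mp hindep (fun ij => c ij.1 ij.2) h' (i, j)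

/-! ### The box inequality -/

/-- **The box inequality of the dynamic box principle** (CDT Appendix §17, §§17.1–17.2, with
the analytic input of §17.3 abstracted into the hypothesis `hbound`):
With `u` a strictly increasing enumeration containing the orders of all non-zero elements of the
evaluation module in degree `< D` (the jumps, `HolonomyBoundJumps.exists_strictMono_orders`),
`T^{mD} ≤ Π_p (2 A_p · den b (u p) + 1)`, `A_p = K / ρ^{u p}`, provided every combination
`W c = Σ c i j • X^j fᵢ` with `|c i j| ≤ T` vanishing to order `≥ n` has `n`-th coefficient
`β` with `|β| ρⁿ ≤ K` (in CDT, `ρ = |φ'(0)|` and `K = m·T·D·(sup_𝕋 max(|u|,|v|))^D · sup_𝕋|h φ^*fᵢ|`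
by the Cauchy estimate (sup bound); the holomorphic case is
`HolonomyBoundGerms.norm_coeff_combo_mul_pow_le`).
Hypotheses: `genFamily b a D` linearly independent (i.e. `ψ_D` injective); `ρ > 0`, `K ≥ 0`.
[cite: CalegariDimitrovTang2024, Appendix §17.2–17.3, `T^{mD} = #𝒪_D ≤ Π_p γ_p` (p. 130)] -/
theorem box_inequality (b : Fin r → ℕ) (a : Fin m → ℕ → ℤ) {D : ℕ}
    (hindep : LinearIndependent ℚ (genFamily b a D))
    {ρ K : ℝ} (hρ : 0 < ρ) (hK : 0 ≤ K) {T : ℕ}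
    (hbound : ∀ c : Fin m → Fin D → ℚ, (∀ i j, |(c i j : ℝ)| ≤ T) →
      ∀ n, (∀ k < n, coeff k (combo (cfOf b a) c) = 0) →
        |((coeff n (combo (cfOf b a) c) : ℚ) : ℝ)| * ρ ^ n ≤ K)
    {u : Fin (Fintype.card (Fin m × Fin D)) → ℕ} (hu : StrictMono u)
    (hu_all : ∀ w ∈ Submodule.span ℚ (Set.range (genFamily b a D)), w ≠ 0 →
      ∃ p, w.order = u p) :
    (T : ℝ) ^ (m * D) ≤ ∏ p, (2 * (K / ρ ^ (u p)) * den b (u p) + 1) := by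
  classical
  -- the evaluation map on the box and the tree map
  let ψ : (Fin m → Fin D → Fin T) → PowerSeries ℚ :=
    fun c => combo (cfOf b a) fun i j => ((c i j : ℕ) : ℚ)
  let Φ : (Fin m → Fin D → Fin T) → (Fin (Fintype.card (Fin m × Fin D)) → ℚ) :=
    fun c p => coeff (u p) (ψ c)
  -- orders of non-zero differences are jumps
  have hdiff : ∀ c₁ c₂ : Fin m → Fin D → Fin T, ψ c₁ - ψ c₂ =
      combo (cfOf b a) (fun i j => ((c₁ i j : ℕ) : ℚ) - ((c₂ i j : ℕ) : ℚ)) :=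
    fun c₁ c₂ => combo_sub _ _ _
  have hψinj : ∀ c₁ c₂ : Fin m → Fin D → Fin T, ψ c₁ = ψ c₂ → c₁ = c₂ := by
    intro c₁ c₂ h
    have h0 : combo (cfOf b a) (fun i j => ((c₁ i j : ℕ) : ℚ) - ((c₂ i j : ℕ) : ℚ)) = 0 := by
      rw [← hdiff, h, sub_self]
    have := combo_eq_zero_imp b a hindep _ h0
    funext i j
    have hij := this i j
    rw [sub_eq_zero] at hij
    exact Fin.ext (by exact_mod_cast hij)
  have hΦinj : Function.Injective Φ := by
    intro c₁ c₂ h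
    by_contra hne
    have hne' : ψ c₁ ≠ ψ c₂ := fun h' => hne (hψinj c₁ c₂ h')
    have hw0 : ψ c₁ - ψ c₂ ≠ 0 := sub_ne_zero.mpr hne'
    have hwspan : ψ c₁ - ψ c₂ ∈ Submodule.span ℚ (Set.range (genFamily b a D)) := by
      rw [hdiff]; exact combo_mem_span b a _
    obtain ⟨p₀, hp₀⟩ := hu_all _ hwspan hw0
    have hcoeff : coeff (u p₀) (ψ c₁ - ψ c₂) ≠ 0 := by
      have h1 := coeff_order hw0
      have h2 : (ψ c₁ - ψ c₂).order.toNat = u p₀ := by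
        rw [← ENat.coe_inj, coe_toNat_order hw0, hp₀]
      rwa [h2] at h1
    apply hcoeff
    rw [map_sub]
    have := congr_fun h p₀
    simp only [Φ] at this
    rw [this, sub_self]
  -- the finite set of coefficient strings and its cardinality
  set S : Finset (Fin (Fintype.card (Fin m × Fin D)) → ℚ) := Finset.univ.image Φ with hS
  have hScard : S.card = T ^ (m * D) := by
    rw [hS, Finset.card_image_of_injective _ hΦinj, Finset.card_univ, Fintype.card_fun,
      Fintype.card_fun, Fintype.card_fin, Fintype.card_fin, Fintype.card_fin, ← pow_mul,
      mul_comm]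
  -- the branching bound at level `p`
  set A : Fin (Fintype.card (Fin m × Fin D)) → ℝ := fun p => K / ρ ^ (u p) with hA
  have hA0 : ∀ p, 0 ≤ A p := fun p => by simp only [hA]; positivity
  have hbranch : ∀ (p : Fin (Fintype.card (Fin m × Fin D)))
      (s : Fin (Fintype.card (Fin m × Fin D)) → ℚ), s ∈ S →
      ((((samePrefix S s p).image fun t => t p).card : ℕ) : ℝ) ≤
        2 * A p * den b (u p) + 1 := by
    intro p s hs
    set Y : Finset ℚ := (samePrefix S s p).image fun t => t p with hY
    -- description of the elements of `Y`
    have hYmem : ∀ y ∈ Y, ∃ c : Fin m → Fin D → Fin T,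
        Φ c ∈ samePrefix S s p ∧ y = coeff (u p) (ψ c) := by
      intro y hy
      obtain ⟨t, ht, rfl⟩ := Finset.mem_image.mp hy
      obtain ⟨htS, -⟩ := mem_samePrefix.mp ht
      obtain ⟨c, -, rfl⟩ := Finset.mem_image.mp htS
      exact ⟨c, ht, rfl⟩
    refine card_le_of_den_dvd_of_diam_le Y (den_pos b (u p)) (hA0 p) ?_ ?_
    · -- denominators
      intro y hy
      obtain ⟨c, -, rfl⟩ := hYmem y hy
      obtain ⟨z, hz⟩ := exists_int_coeff_eq_div_den b a (fun i j => ((c i j : ℕ) : ℤ)) (u p)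
      refine ⟨z, ?_⟩
      rw [← hz]
      simp only [ψ, combo, Int.cast_natCast]
      rfl
    · -- diameter
      intro y₁ hy₁ y₂ hy₂
      obtain ⟨c₁, hc₁, rfl⟩ := hYmem y₁ hy₁
      obtain ⟨c₂, hc₂, rfl⟩ := hYmem y₂ hy₂
      set w : PowerSeries ℚ := ψ c₁ - ψ c₂ with hw
      have hwcombo : w = combo (cfOf b a) (fun i j => ((c₁ i j : ℕ) : ℚ) - ((c₂ i j : ℕ) : ℚ)) :=
        hdiff c₁ c₂
      -- the coefficients of `w` below `u p` vanish
      have hlow : ∀ k < u p, coeff k w = 0 := by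
        by_cases hw0 : w = 0
        · intro k _; rw [hw0, map_zero]
        · have hwspan : w ∈ Submodule.span ℚ (Set.range (genFamily b a D)) := by
            rw [hwcombo]; exact combo_mem_span b a _
          obtain ⟨p₁, hp₁⟩ := hu_all w hwspan hw0
          -- `p ≤ p₁`: the coefficients of `w` at `u q`, `q < p`, vanish
          have hpp₁ : p ≤ p₁ := by
            by_contra hlt
            push Not at hlt
            have hc := coeff_order hw0
            have h2 : w.order.toNat = u p₁ := by
              rw [← ENat.coe_inj, coe_toNat_order hw0, hp₁]
            rw [h2] at hc
            apply hc
            obtain ⟨-, hpre₁⟩ := mem_samePrefix.mp hc₁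
            obtain ⟨-, hpre₂⟩ := mem_samePrefix.mp hc₂
            rw [hw, map_sub]
            have e1 : coeff (u p₁) (ψ c₁) = s p₁ := hpre₁ p₁ hlt
            have e2 : coeff (u p₁) (ψ c₂) = s p₁ := hpre₂ p₁ hlt
            rw [e1, e2, sub_self]
          intro k hk
          apply coeff_of_lt_order
          rw [hp₁]
          exact_mod_cast lt_of_lt_of_le hk (hu.monotone hpp₁)
      -- the analytic bound on the `u p`-th coefficient of `w`
      have hTbd : ∀ i j, |((((c₁ i j : ℕ) : ℚ) - ((c₂ i j : ℕ) : ℚ) : ℚ) : ℝ)| ≤ T := by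
        intro i j
        have h1 : ((c₁ i j : ℕ) : ℝ) < T := by exact_mod_cast (c₁ i j).isLt
        have h2 : ((c₂ i j : ℕ) : ℝ) < T := by exact_mod_cast (c₂ i j).isLt
        have h3 : (0 : ℝ) ≤ ((c₁ i j : ℕ) : ℝ) := Nat.cast_nonneg _
        have h4 : (0 : ℝ) ≤ ((c₂ i j : ℕ) : ℝ) := Nat.cast_nonneg _
        push_cast
        rw [abs_le]
        constructor <;> linarith
      have hest := hbound (fun i j => ((c₁ i j : ℕ) : ℚ) - ((c₂ i j : ℕ) : ℚ)) hTbd (u p)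
        (by rw [← hwcombo]; exact hlow)
      rw [← hwcombo] at hest
      -- `coeff (u p) w = y₁ - y₂`
      have hcw : coeff (u p) w = coeff (u p) (ψ c₁) - coeff (u p) (ψ c₂) := by
        rw [hw, map_sub]
      rw [hcw, Rat.cast_sub] at hest
      have hρn : 0 < ρ ^ u p := pow_pos hρ _
      rw [hA]
      simp only
      rw [le_div_iff₀ hρn]
      exact hest
  -- tree counting
  set γ : Fin (Fintype.card (Fin m × Fin D)) → ℕ := fun p => ⌊2 * A p * den b (u p)⌋₊ + 1 with hγ
  have hγbd : ∀ (p : Fin (Fintype.card (Fin m × Fin D)))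
      (s : Fin (Fintype.card (Fin m × Fin D)) → ℚ), s ∈ S →
      ((samePrefix S s p).image fun t => t p).card ≤ γ p := by
    intro p s hs
    have h := hbranch p s hs
    have hx0 : 0 ≤ 2 * A p * den b (u p) := by have := hA0 p; positivity
    -- `card ≤ 2 A den + 1 < ⌊2 A den⌋₊ + 2`
    have h2 : (((samePrefix S s p).image fun t => t p).card : ℝ) <
        (⌊2 * A p * den b (u p)⌋₊ : ℕ) + 2 := by
      have := Nat.lt_floor_add_one (2 * A p * den b (u p))
      linarith
    have h3 : ((samePrefix S s p).image fun t => t p).card < ⌊2 * A p * den b (u p)⌋₊ + 2 := by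
      exact_mod_cast h2
    simp only [hγ]
    omega
  have hcount := card_le_prod_of_forall_card_image_le S γ hγbd
  rw [hScard] at hcount
  -- pass to the reals
  have hcountR : ((T ^ (m * D) : ℕ) : ℝ) ≤ ∏ p, (γ p : ℝ) := by exact_mod_cast hcount
  push_cast at hcountR
  refine le_trans hcountR (Finset.prod_le_prod (fun p _ => by positivity) fun p _ => ?_)
  simp only [hγ]
  push_cast
  have hx0 : 0 ≤ 2 * A p * den b (u p) := by have := hA0 p; positivity
  have := Nat.floor_le hx0
  simp only [hA] at this ⊢
  linarith

end HolonomyBound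

end Literature.NumberTheory.Transcendental
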